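import Summits.AtomisticToContinuum.Crystallization.Theses.ReggeStarCoercivity
import Summits.AtomisticToContinuum.Crystallization.Theses.PhononSlackCertificates
import Literature.Geometry.DiscreteGeometry.TwoShellPatterns
import Literature.MathematicalPhysics.StatisticalMechanics.LennardJonesClusters
import Literature.MathematicalPhysics.StatisticalMechanics.StablePotentialsProofs
import Summits.AtomisticToContinuum.Crystallization.Theorems.ThreeConeCertificateSlackRigidityThinning

/-!
# Line `separation-padding-transfer` — crux `ReggeStarCoercivity.StarCoercivity` (stmt-AtomisticToContinuum-13600)

Skeleton of the line (crux-plan, planner-cruxplan-stmt-AtomisticToContinuum-13600-separation-padding-t-0,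
2026-08-16) for the triaged crux idea `Ideas/separation-padding-transfer.md` (crux-ideate r1, ideator 2; triage
r1: 3 × pass, with the sharpenings "drop lever (ii) padding — it is `Disproof.lean` §9/§12 verbatim", "the residual
deliverables are `SeparationRemovable` (L1) and `TwoShellGoodImpliesStarGood` (L3), both M-sized", "do the deletion
on the FINITE side", "state L1 with the explicit cap `min g (−e_per/56)`").

THE CRUX (fixed). `StarCoercivity`: `∃ g > 0, ∃ C, ∀ N, ∀ x : Fin N → ℝ³` injective,
`N·e_per + g·#Def(x) − C·N^(2/3) ≤ E_LJ(x)`, where `e_per = ⨅_Q e(Q)` over `PeriodicConfiguration 3` and site `i` is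
DEFECTIVE unless its recentred `6/5`-shell, rescaled by some `a ∈ [9/10, 11/10]`, is `1/20`-matched after a linear
isometry to `fccKissingPattern` or `hcpKissingPattern`.

THE LINE (a TRANSFER; kind of the card): the crux is never attacked in its own finite, unseparated, boundary-charged
form. Two hypotheses are removable for free and one sibling target already implies it:

1. `stub_closestPairDeletion` (L1, M, PROVABLE NOW) — SEPARATION IS REMOVABLE. If the inequality holds with constants
   `(g, C)` for all `1/3`-SEPARATED injective configurations, it holds with `(min g (−e_per/56), max C 0)` for ALL
   injective configurations. Mechanism: induction on `N`; at a closest pair of distance `r < 1/3` the configuration is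
   `r`-separated, so the shell sum `sum_inv_pow_six_le` (constant `250`) gives site energy
   `s_{i₀} ≥ r⁻⁶(r⁻⁶/12 − 250/6) > 0` (`r⁻⁶ > 729 > 500`; the tree's argument inside
   `LennardJonesMinimalDistance_holds`); deleting `i₀` gives `E(x) = E(x ∖ i₀) + s_{i₀} > E(x ∖ i₀)`, costs `|e_per|` on
   the left, and flips at most `1 + 55` defect flags: the sites of `x ∖ i₀` that are GOOD and lie in `B(x_{i₀}, 6/5)`
   are pairwise `≥ 0.9·0.95 = 0.855` apart (each lies in the other's matched shell or is `> 6/5` away), so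
   `card_le_of_separated_of_dist_le` bounds them by `(2·(6/5)/0.855 + 1)³ = 55.2`. The induction closes iff
   `56·g' ≤ −e_per`, whence the cap. Injectivity is USED here (the closest pair has `r > 0`): this is where the line
   honours `Disproof.lean` §4 `not_starCoercivityNonInj` (the crux is false without `Function.Injective x`).
2. `stub_twoShellGoodStarGood` (L3, M, PROVABLE NOW) — pattern arithmetic: a particle that is two-shell good in the
   sense of `IsTwoShellGood (1/20) (47/50) 1` (two-way `a/20`-match of the `3a/2`-neighbourhood with a rotated fcc/hcp
   18-point pattern, `a ∈ [47/50, 1]`) is star-good in the sense of the crux: second-shell pattern images sit at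
   `≥ a(√2 − 1/20) ≥ 1.2824 > 6/5`, first-shell images at `≤ 21a/20 ≤ 1.05 < 6/5`, coverage `3a/2 ≥ 1.41 > 6/5`, so the
   absolute `6/5`-shell is exactly the twelve first-shell images and `a⁻¹`-rescaling turns the `a/20`-match into the
   crux's `1/20`-match with the same isometry and `a ∈ [0.94, 1] ⊂ [0.9, 1.1]`.
3. `stub_separatedTwoShellGap` (R2, XL, OPEN — THE HARDEST STUB, shared): the COERCIVE TWO-SHELL GAP on
   `1/3`-separated configurations, `∃ g > 0, ∃ C, ∀ 1/3-separated x, N·e_per + g·#{i not two-shell good} − C·N^(2/3)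
   ≤ E_LJ(x)` — the `δ = 1/3` instance of the sibling target `PhononSlackCertificates.CoerciveTwoShellGap`
   (stmt-13956, there with `C = 0`; `sepTwoShellGap_of_coerciveTwoShellGap` below is the kernel-checked entry), whose
   route decomposes it as far field (13957) + near-field convexity (13958) + levy (13959) — the two-tier architecture
   the triage panel converged on for THIS crux as well (cards threshold-substitution-handover ≈ elastic-tier ≈ ladder),
   with the triage's two repairs owed (signed interface functional instead of flat collar constants; density window).
   WHY THIS FORM IS THE RIGHT RESIDUAL: (a) separation gives bounded valence (`≤ 55` neighbours within `6/5`), finitely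
   many combinatorial star types per volume and a certified `r⁻⁶` tail (`sum_inv_pow_six_le`) — no "unseparated tail
   charge", no ghost vertices; (b) the two-shell FREE population (`a ∈ [0.94, 1]`, first-shell distances in
   `[0.893, 1.05]`) stays below the uniform-dilation inflection `d = (13/7)^(1/6)·a* = 1.077` of Lennard-Jones fcc, so
   the near field's force-constant form is positive on the whole free window (the one-shell window `[0.855, 1.155]` of
   the crux crosses that spinodal — triage r1-3 (b)); (c) 18-point two-way matching pins the environment (graph forcing
   `4θ = 0.2 < √2 − 1`), which is what a robust layer lemma needs; (d) it is STAFFED ONCE for two routes.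

`StarCoercivity_of` composes the three stubs into the crux BY NAME (kernel-checked; `sorry` only inside the three
`stub_*`): R2 and L3 give the separated one-shell inequality `SepStarCoercivityWith g C` (`#Def₁ ≤ #bad₂`); the
vacuum competitor (collinear points at spacing `2`, PROVED here after `Disproof.lean` §2–3) gives `e_per ≤ −g < 0`;
L1 then yields `StarCoercivityWith (min g (−e_per/56)) (max C 0)` with a positive constant, i.e. the crux.

OTHER ENTRIES (kernel-checked, not registered): `starCoercivityBody_of_sepStar` — a direct proof of the separated
ONE-shell inequality `SepStarCoercivity` (the natural target of the route's own Regge/LP engine and of the handover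
cards, which quantify over `1/3`-separated `x`) closes the crux through L1 alone (`Iff.rfl` with the crux:
`starCoercivity_iff`); the TORUS entry `TorusTwoShellGap → SepTwoShellGap` (`SeparatedPeriodisation`, periodisation
with period `> diam + 2`, the pattern of `Disproof.lean` §9 `starCoercivity_of_periodicStarCoercivity`) is stated as a
`def` only — by triage r1 the padding lever is not re-filed as a stub; a lead working on `ℝ³/Λ` promotes it with one
`theorem stub_separatedPeriodisation : SeparatedPeriodisation := by sorry` and re-runs `skeleton check`. The one-shell
torus entry is item 13602 itself (`Disproof.lean` §9/§12: `StarCoercivity ↔ PeriodicStarCoercivity`, same `g`).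

## Disproof used (`Cruxes/StarCoercivity/Disproof.lean`, cdisprove g3 v9, read 2026-08-16)
* §4 `not_starCoercivityNonInj` (= `_false_without_injective`): HONOURED — L1 keeps `Function.Injective x` and uses it
  (closest pair at positive distance; deletion never piles up); R2/L3 work under `1/3`-separation, which implies it.
* §8 `StarCoercivityWith.zero_slack` (the `C·N^(2/3)` allowance is redundant): the residual R2 nevertheless KEEPS
  `∃ C` (a weaker stub is a cheaper stub; L1 carries `C` through as `max C 0`).
* §9/§12 `starCoercivity_of_periodicStarCoercivity` / `starCoercivity_iff_periodicStarCoercivity`: the card's lever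
  (ii) is these theorems — not re-filed (triage), recorded as the one-shell torus entry above.
* §3 `g_le_neg_ePer` (vacuum tightness): re-proved here for the separated inequality (`g_le_neg_ePer_of_sep`), it is
  the glue that makes L1's constant positive. §10 `gStar`: the line's cap `g ≤ −e_per/56 ≈ 1.3e-2` sits above the
  physics ledger's binding `5.7e-3` (threshold slip), so L1 loses nothing that matters.
* Landed Negative lemmas under `Theorems/StarCoercivity/Negative/`: none at this date (directory absent); negatives
  index (Crystallization): 4146 `EffectiveLocalHales_refuted`, 3506 `OneGrainGluing_refuted` — neither is an instance
  of a stub (3506's pile-up witness is non-injective/non-separated).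
-/

noncomputable section

open scoped BigOperators Classical
open Literature.MathematicalPhysics.StatisticalMechanics Literature.Geometry.DiscreteGeometry

namespace Summit.AtomisticToContinuum.Crystallization.Cruxes.StarCoercivity.SeparationPaddingTransfer

/-- Euclidean `3`-space. -/
local notation "E3" => EuclideanSpace ℝ (Fin 3)

/-! ## Vocabulary (readable names, verbatim sub-terms of the crux; the registered stubs inline everything) -/

/-- `e_per = ⨅_Q e(Q)` over periodic configurations of `ℝ³` (conditionally complete infimum). -/
def ePer : ℝ := ⨅ Q : PeriodicConfiguration 3, Q.energyPerParticle lennardJones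

/-- The recentred, `a⁻¹`-rescaled first shell of absolute radius `6/5` of site `i` (verbatim from the crux). -/
def shell {N : ℕ} (x : Fin N → E3) (i : Fin N) (a : ℝ) : Finset E3 :=
  (Finset.univ.filter fun j : Fin N => j ≠ i ∧ dist (x i) (x j) ≤ 6 / 5).image fun j => a⁻¹ • (x j - x i)

/-- Site `i` is STAR-GOOD (the negation of the crux's defect predicate, verbatim). -/
def IsStarGood {N : ℕ} (x : Fin N → E3) (i : Fin N) : Prop :=
  ∃ a : ℝ, 9 / 10 ≤ a ∧ a ≤ 11 / 10 ∧
    (ShellCloseTo (1 / 20) (shell x i a) fccKissingPattern ∨ ShellCloseTo (1 / 20) (shell x i a) hcpKissingPattern)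

/-- `#Def(x)`, the number of star-defective sites (verbatim from the crux). -/
def defects {N : ℕ} (x : Fin N → E3) : ℕ := Nat.card {i : Fin N // ¬ IsStarGood x i}

/-- `#Bad₂(x)`, the number of sites that are not two-shell good at tolerance `1/20`, scale window `[47/50, 1]`
(the predicate of `PhononSlackCertificates.CoerciveTwoShellGap`, stmt-13956). -/
def twoShellDefects {N : ℕ} (x : Fin N → E3) : ℕ :=
  Nat.card {i : Fin N // ¬ IsTwoShellGood (1 / 20) (47 / 50) 1 x i}

/-- `x` is `1/3`-separated (the tree's minimal distance of LJ ground states, `LennardJonesMinimalDistance_holds`). -/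
def IsSeparated {N : ℕ} (x : Fin N → E3) : Prop := ∀ i j : Fin N, i ≠ j → (1 / 3 : ℝ) ≤ dist (x i) (x j)

/-- The crux inequality with both constants exposed (as in `Disproof.lean` §0). -/
def StarCoercivityWith (g C : ℝ) : Prop :=
  ∀ (N : ℕ) (x : Fin N → E3), Function.Injective x →
    (N : ℝ) * ePer + g * (defects x : ℝ) - C * (N : ℝ) ^ (2 / 3 : ℝ) ≤ interactionEnergy lennardJones x

/-- The same inequality demanded only of `1/3`-SEPARATED injective configurations (R1 with constants). -/
def SepStarCoercivityWith (g C : ℝ) : Prop :=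
  ∀ (N : ℕ) (x : Fin N → E3), Function.Injective x → IsSeparated x →
    (N : ℝ) * ePer + g * (defects x : ℝ) - C * (N : ℝ) ^ (2 / 3 : ℝ) ≤ interactionEnergy lennardJones x

/-- The two-shell coercive gap on `1/3`-separated configurations with constants `(g, C)` (R2 with constants). -/
def SepTwoShellGapWith (g C : ℝ) : Prop :=
  ∀ (N : ℕ) (x : Fin N → E3), IsSeparated x →
    (N : ℝ) * ePer + g * (twoShellDefects x : ℝ) - C * (N : ℝ) ^ (2 / 3 : ℝ) ≤ interactionEnergy lennardJones x

/-- The crux is literally `∃ g > 0, ∃ C, StarCoercivityWith g C`. -/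
theorem starCoercivity_iff :
    Summit.AtomisticToContinuum.Crystallization.Theses.ReggeStarCoercivity.StarCoercivity ↔
      ∃ g : ℝ, 0 < g ∧ ∃ C : ℝ, StarCoercivityWith g C :=
  Iff.rfl

/-! ## The three stub STATEMENTS (named `Prop`s) -/

/-- Statement of STUB 1 — CLOSEST-PAIR DELETION (separation is removable, explicit constants). -/
def ClosestPairDeletion : Prop :=
  ∀ g C : ℝ, 0 < g → ePer < 0 → SepStarCoercivityWith g C → StarCoercivityWith (min g (-ePer / 56)) (max C 0)

/-- Statement of STUB 2 — TWO-SHELL GOOD ⇒ STAR GOOD (pattern arithmetic). -/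
def TwoShellGoodStarGood : Prop :=
  ∀ (N : ℕ) (x : Fin N → E3) (i : Fin N), Function.Injective x →
    IsTwoShellGood (1 / 20) (47 / 50) 1 x i → IsStarGood x i

/-- Statement of STUB 3 — the SEPARATED TWO-SHELL GAP (the residual crux, shared with stmt-13956 at `δ = 1/3`). -/
def SepTwoShellGap : Prop :=
  ∃ g : ℝ, 0 < g ∧ ∃ C : ℝ, SepTwoShellGapWith g C

/-- R1 — the separated ONE-shell inequality with some positive constant (the other direct entry, see
`starCoercivityBody_of_sepStar`). Not a registered stub. -/
def SepStarCoercivity : Prop :=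
  ∃ g : ℝ, 0 < g ∧ ∃ C : ℝ, SepStarCoercivityWith g C

/-! ## The registered stubs (`sorry` lives only in these three theorems; signatures fully inlined and qualified so
that a `Theorems/`-side `propose --supports stmt-AtomisticToContinuum-13600` proof can restate them textually) -/

/-- **STUB 1 · `stub_deletionGlue`** (S/M, PROVABLE NOW; reshaped by the lead 2026-08-16: the defect-count step `#Def(x) ≤ #Def(x ∘ i₀.succAbove) + 56` is now the HYPOTHESIS, supplied by stubs B + C through `stub_defectsGlue`; what remains here is the closest-pair induction with `exists_le_siteEnergy_of_dist_lt` + `interactionEnergy_eq_succAbove_add_siteEnergy`) — for `g > 0`, `e_per < 0`: the crux inequality with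
constants `(g, C)` on `1/3`-separated injective configurations implies it with `(min g (−e_per/56), max C 0)` on all
injective configurations. Proof route (card L1, checked by all three triagers): strong induction on `N`; a
non-separated injective `x` has a closest pair `(i₀, j₀)` at `0 < r < 1/3` (`Finset.exists_min_image` on
`univ.offDiag`, as in `LennardJonesMinimalDistance_holds`); `x` is `r`-separated, so `sum_inv_pow_six_le` gives
`siteEnergy lennardJones x i₀ ≥ r⁻¹²/12 − (250/6)r⁻⁶ > 0` (`r⁻⁶ > 729`); with `x' = x ∘ i₀.succAbove`:
`E(x) = E(x') + siteEnergy x i₀` (`two_mul_interactionEnergy` / `Fin.sum_univ_succAbove` bookkeeping),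
`#Def(x) ≤ #Def(x') + 56` (the sites `j ≠ i₀` with `dist (x j) (x i₀) ≤ 6/5` that are good in `x'` are pairwise
`≥ 171/200` apart — matched shells: two shell points are within `a/20` of distinct pattern points at mutual distance
`≥ a`, `a ≥ 9/10` — so `card_le_of_separated_of_dist_le` gives `≤ (2·(6/5)·(200/171) + 1)³ < 56`; shells of sites
farther than `6/5` from `x i₀` are unchanged), and the step closes by `56·g' ≤ −e_per`, `g' ≤ g`, `max C 0 ≥ 0`,
`(N−1)^(2/3) ≤ N^(2/3)`. Leans on: `siteEnergy`, `two_mul_interactionEnergy`, `sum_inv_pow_six_le`,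
`card_le_of_separated_of_dist_le`, `one_le_dist_of_mem_fcc/hcpKissingPattern`, `norm_eq_one_of_mem_…`,
`EtaMatched`, `ShellCloseTo`. Uses injectivity (Disproof §4). -/
theorem stub_deletionGlue : (∀ (N : ℕ) (x : Fin (N + 1) → EuclideanSpace ℝ (Fin 3)) (i₀ : Fin (N + 1)), Function.Injective x → Nat.card {i : Fin (N + 1) // ¬ ∃ a : ℝ, 9 / 10 ≤ a ∧ a ≤ 11 / 10 ∧ (Literature.Geometry.DiscreteGeometry.ShellCloseTo (1 / 20) ((Finset.univ.filter fun j : Fin (N + 1) => j ≠ i ∧ dist (x i) (x j) ≤ 6 / 5).image fun j => a⁻¹ • (x j - x i)) Literature.Geometry.DiscreteGeometry.fccKissingPattern ∨ Literature.Geometry.DiscreteGeometry.ShellCloseTo (1 / 20) ((Finset.univ.filter fun j : Fin (N + 1) => j ≠ i ∧ dist (x i) (x j) ≤ 6 / 5).image fun j => a⁻¹ • (x j - x i)) Literature.Geometry.DiscreteGeometry.hcpKissingPattern)} ≤ Nat.card {i : Fin N // ¬ ∃ a : ℝ, 9 / 10 ≤ a ∧ a ≤ 11 / 10 ∧ (Literature.Geometry.DiscreteGeometry.ShellCloseTo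 (1 / 20) ((Finset.univ.filter fun j : Fin N => j ≠ i ∧ dist (x (Fin.succAbove i₀ i)) (x (Fin.succAbove i₀ j)) ≤ 6 / 5).image fun j => a⁻¹ • (x (Fin.succAbove i₀ j) - x (Fin.succAbove i₀ i))) Literature.Geometry.DiscreteGeometry.fccKissingPattern ∨ Literature.Geometry.DiscreteGeometry.ShellCloseTo (1 / 20) ((Finset.univ.filter fun j : Fin N => j ≠ i ∧ dist (x (Fin.succAbove i₀ i)) (x (Fin.succAbove i₀ j)) ≤ 6 / 5).image fun j => a⁻¹ • (x (Fin.succAbove i₀ j) - x (Fin.succAbove i₀ i))) Literature.Geometry.DiscreteGeometry.hcpKissingPattern)} + 56) → ∀ g C : ℝ, 0 < g → (⨅ Q : Literature.MathematicalPhysics.StatisticalMechanics.PeriodicConfiguration 3, Q.energyPerParticle Literature.MathematicalPhysics.StatisticalMechanics.lennardJones) < 0 → (∀ (N : ℕ) (x : Fin N → EuclideanSpace ℝ (Fin 3)), Function.Injective x → (∀ i j : Fin N, i ≠ j → (1 / 3 : ℝ) ≤ dist (x i) (x j)) → (N : ℝ) * (⨅ Q : Literature.MathematicalPhysics.StatisticalMechanics.PeriodicConfiguration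 3, Q.energyPerParticle Literature.MathematicalPhysics.StatisticalMechanics.lennardJones) + g * (Nat.card {i : Fin N // ¬ ∃ a : ℝ, 9 / 10 ≤ a ∧ a ≤ 11 / 10 ∧ (Literature.Geometry.DiscreteGeometry.ShellCloseTo (1 / 20) ((Finset.univ.filter fun j : Fin N => j ≠ i ∧ dist (x i) (x j) ≤ 6 / 5).image fun j => a⁻¹ • (x j - x i)) Literature.Geometry.DiscreteGeometry.fccKissingPattern ∨ Literature.Geometry.DiscreteGeometry.ShellCloseTo (1 / 20) ((Finset.univ.filter fun j : Fin N => j ≠ i ∧ dist (x i) (x j) ≤ 6 / 5).image fun j => a⁻¹ • (x j - x i)) Literature.Geometry.DiscreteGeometry.hcpKissingPattern)} : ℝ) - C * (N : ℝ) ^ (2 / 3 : ℝ) ≤ Literature.MathematicalPhysics.StatisticalMechanics.interactionEnergy Literature.MathematicalPhysics.StatisticalMechanics.lennardJones x) → ∀ (N : ℕ) (x : Fin N → EuclideanSpace ℝ (Fin 3)), Function.Injective x → (N : ℝ) * (⨅ Q : Literature.MathematicalPhysics.StatisticalMechanics.PeriodicConfiguration 3, Q.energyPerParticle Literature.MathematicalPhysics.StatisticalMechanics.lennardJones)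 + min g (-(⨅ Q : Literature.MathematicalPhysics.StatisticalMechanics.PeriodicConfiguration 3, Q.energyPerParticle Literature.MathematicalPhysics.StatisticalMechanics.lennardJones) / 56) * (Nat.card {i : Fin N // ¬ ∃ a : ℝ, 9 / 10 ≤ a ∧ a ≤ 11 / 10 ∧ (Literature.Geometry.DiscreteGeometry.ShellCloseTo (1 / 20) ((Finset.univ.filter fun j : Fin N => j ≠ i ∧ dist (x i) (x j) ≤ 6 / 5).image fun j => a⁻¹ • (x j - x i)) Literature.Geometry.DiscreteGeometry.fccKissingPattern ∨ Literature.Geometry.DiscreteGeometry.ShellCloseTo (1 / 20) ((Finset.univ.filter fun j : Fin N => j ≠ i ∧ dist (x i) (x j) ≤ 6 / 5).image fun j => a⁻¹ • (x j - x i)) Literature.Geometry.DiscreteGeometry.hcpKissingPattern)} : ℝ) - max C 0 * (N : ℝ) ^ (2 / 3 : ℝ) ≤ Literature.MathematicalPhysics.StatisticalMechanics.interactionEnergy Literature.MathematicalPhysics.StatisticalMechanics.lennardJones x := by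
  sorry

/-- **STUB 2 · `stub_twoShellGoodStarGood`** (M, PROVABLE NOW) — a two-shell-good particle (`IsTwoShellGood (1/20)
(47/50) 1 x i`: scale `a ∈ [47/50, 1]`, linear isometry `A`, pattern `P ∈ {fccTwoShellPattern, hcpTwoShellPattern}`,
assignment `f` injective on `P` with `dist (x (f v)) (x i + a • A v) ≤ a/20`, every `j ≠ i` within `3a/2` assigned)
is star-good at the same `(a, A)`. Proof route (card L3): a particle `j ≠ i` with `dist ≤ 6/5 ≤ 3a/2` is `f v` for a
unique `v ∈ P`; if `‖v‖ = √2` then `dist (x j) (x i) ≥ a(√2 − 1/20) > 6/5` (`norm_of_mem_fcc/hcpTwoShellPattern`,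
`47/50·(√2 − 1/20) ≥ 1.2824`), so `v` lies in the first shell `K = fcc/hcpKissingPattern` (`…KissingPattern_subset`,
norm-`1` points of `P` are exactly `K`: integer arithmetic on `scaledPattern`); conversely every `v ∈ K` has
`dist (x (f v)) (x i) ≤ 21a/20 < 6/5`. Hence `j ↦ A v_j` is a bijection from the `6/5`-shell (an image finset;
injectivity of `x` makes `j ↦ a⁻¹ • (x j − x i)` injective) onto `K.image A` moving each rescaled point by
`a⁻¹ · (a/20) = 1/20`: `EtaMatched (1/20) (shell x i a) (K.image A.toLinearIsometry)`, and `a ∈ [0.94, 1] ⊂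
[0.9, 1.1]`. Leans on: `IsTwoShellGood`, `fccKissingPattern_subset`, `hcpKissingPattern_subset`,
`norm_of_mem_fccTwoShellPattern`, `norm_eq_one_of_mem_fccKissingPattern`, `card_fccKissingPattern`,
`one_le_dist_of_mem_fccKissingPattern`, `EtaMatched`, `ShellCloseTo`, `LinearIsometryEquiv`/`LinearIsometry` coercions. -/
theorem stub_twoShellGoodStarGood : ∀ (N : ℕ) (x : Fin N → EuclideanSpace ℝ (Fin 3)) (i : Fin N), Function.Injective x → Literature.Geometry.DiscreteGeometry.IsTwoShellGood (1 / 20) (47 / 50) 1 x i → ∃ a : ℝ, 9 / 10 ≤ a ∧ a ≤ 11 / 10 ∧ (Literature.Geometry.DiscreteGeometry.ShellCloseTo (1 / 20) ((Finset.univ.filter fun j : Fin N => j ≠ i ∧ dist (x i) (x j) ≤ 6 / 5).image fun j => a⁻¹ • (x j - x i)) Literature.Geometry.DiscreteGeometry.fccKissingPattern ∨ Literature.Geometry.DiscreteGeometry.ShellCloseTo (1 / 20) ((Finset.univ.filter fun j : Fin N => j ≠ i ∧ dist (x i) (x j) ≤ 6 / 5).image fun j => a⁻¹ • (x j - x i))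 Literature.Geometry.DiscreteGeometry.hcpKissingPattern) := by
  sorry

/-- **STUB 3 · `stub_separatedTwoShellGap`** (XL, OPEN — the hardest stub; shared with route PhononSlackCertificates:
it is `CoerciveTwoShellGap` (stmt-13956) at `δ = 1/3` with an extra `C·N^(2/3)` allowance, see
`sepTwoShellGap_of_coerciveTwoShellGap`) — there are `g > 0` and `C` such that every `1/3`-separated configuration
of `N` points of `ℝ³` has `E_LJ(x) ≥ N·e_per + g·#{i : ¬ IsTwoShellGood (1/20) (47/50) 1 x i} − C·N^(2/3)`. Why
plausibly true: the `g = 0` part is a theorem (`Disproof.lean` §5, periodisation); every probed defect family has a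
positive excess-per-bad-site quotient (physics ledger of `Disproof.lean`: vacuum 0.72, surfaces ≥ 0.17, bcc 0.031,
vacancy ≈ 0.04 with 18 charged sites, threshold slips 5.7e-3, threshold Bain 8.4e-3; FK phases ~1e-2 pending
j011079), and the free population (two-shell good, `nn ∈ [0.893, 1.05]`) is Born-stable fcc/hcp-like below the
dilation spinodal `1.077`. Intended architecture (sibling items 13957–13959 as repaired by triage r1): far field =
slack-only certificate on bad sites against an explicit threshold `e(hcp(a,h)) + g` (`ciInf_le`), near field =
convexity of the layered family in co-rotated frames, glued by a SIGNED interface functional. Why it might fail: a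
thick all-bad phase (Frank–Kasper σ/A15, Coxeter froth statistics) within certificate error of `e_per`, or the levy
between the tiers not closing at any affordable certificate radius. -/
theorem stub_separatedTwoShellGap : ∃ g : ℝ, 0 < g ∧ ∃ C : ℝ, ∀ (N : ℕ) (x : Fin N → EuclideanSpace ℝ (Fin 3)), (∀ i j : Fin N, i ≠ j → (1 / 3 : ℝ) ≤ dist (x i) (x j)) → (N : ℝ) * (⨅ Q : Literature.MathematicalPhysics.StatisticalMechanics.PeriodicConfiguration 3, Q.energyPerParticle Literature.MathematicalPhysics.StatisticalMechanics.lennardJones) + g * (Nat.card {i : Fin N // ¬ Literature.Geometry.DiscreteGeometry.IsTwoShellGood (1 / 20) (47 / 50) 1 x i} : ℝ) - C * (N : ℝ) ^ (2 / 3 : ℝ) ≤ Literature.MathematicalPhysics.StatisticalMechanics.interactionEnergy Literature.MathematicalPhysics.StatisticalMechanics.lennardJones x := by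
  sorry

/-! ### Reshaped stubs of the lead (2026-08-16): the deletion step of STUB 1 split into B (far shells), C (near good count), D (count glue) -/

/-- **STUB B · `stub_shellSuccAbove`** (S, PROVABLE NOW) — deleting a particle `i₀` does not change the recentred rescaled
`6/5`-shell of a site farther than `6/5` from `x i₀`: the shell of `i₀.succAbove j` read in `x` equals the shell of `j` read in
`x ∘ i₀.succAbove` (Finset extensionality; `Fin.exists_succAbove_eq`, `Fin.succAbove_right_injective`, `Fin.succAbove_ne`). -/
theorem stub_shellSuccAbove : ∀ (N : ℕ) (x : Fin (N + 1) → EuclideanSpace ℝ (Fin 3)) (i₀ : Fin (N + 1)) (j : Fin N) (a : ℝ), 6 / 5 < dist (x (Fin.succAbove i₀ j)) (x i₀) → ((Finset.univ.filter fun k : Fin (N + 1) => k ≠ Fin.succAbove i₀ j ∧ dist (x (Fin.succAbove i₀ j)) (x k) ≤ 6 / 5).image fun k => a⁻¹ • (x k - x (Fin.succAbove i₀ j))) = ((Finset.univ.filter fun k : Fin N => k ≠ j ∧ dist (x (Fin.succAbove i₀ j)) (x (Fin.succAbove i₀ k)) ≤ 6 / 5).image fun k => a⁻¹ • (x (Fin.succAbove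 i₀ k) - x (Fin.succAbove i₀ j))) := by
  sorry

/-- **STUB C · `stub_nearGoodCount`** (M, PROVABLE NOW) — at most `55` STAR-GOOD sites of any configuration lie within `6/5`
of a given point `p`: two distinct good sites `j ≠ k` within `6/5` of `p` are `≥ 171/200` apart (if `dist (y j) (y k) ≤ 6/5` then
`a⁻¹ • (y k − y j)` is a point of `j`'s matched shell, within `1/20` of a unit vector `A v`, so `‖y k − y j‖ ≥ a·(19/20) ≥ 171/200`;
pattern points have norm `1`: `norm_eq_one_of_mem_fcc/hcpKissingPattern`, `LinearIsometry.norm_map`), and the packing bound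
`card_le_of_separated_of_dist_le` gives `≤ (2·(6/5)·(200/171) + 1)³ = (651/171)³ < 56`. No injectivity needed. -/
theorem stub_nearGoodCount : ∀ (N : ℕ) (y : Fin N → EuclideanSpace ℝ (Fin 3)) (p : EuclideanSpace ℝ (Fin 3)), ((Finset.univ.filter fun i : Fin N => dist (y i) p ≤ 6 / 5 ∧ ∃ a : ℝ, 9 / 10 ≤ a ∧ a ≤ 11 / 10 ∧ (Literature.Geometry.DiscreteGeometry.ShellCloseTo (1 / 20) ((Finset.univ.filter fun j : Fin N => j ≠ i ∧ dist (y i) (y j) ≤ 6 / 5).image fun j => a⁻¹ • (y j - y i)) Literature.Geometry.DiscreteGeometry.fccKissingPattern ∨ Literature.Geometry.DiscreteGeometry.ShellCloseTo (1 / 20) ((Finset.univ.filter fun j : Fin N => j ≠ i ∧ dist (y i) (y j) ≤ 6 / 5).image fun j => a⁻¹ • (y j - y i)) Literature.Geometry.DiscreteGeometry.hcpKissingPattern))).card ≤ 55 := by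
  sorry

/-- **STUB D · `stub_defectsGlue`** (S/M, PROVABLE NOW; pure counting) — from B (far shells unchanged) and C (≤ 55 good sites near any point):
deleting one particle raises the star-defect count by at most `56`, `#Def(x) ≤ #Def(x ∘ i₀.succAbove) + 56` (a site defective in `x`
is `i₀` itself, or defective after deletion, or good after deletion and then — by B — within `6/5` of `x i₀`, counted by C with
`y = x ∘ i₀.succAbove`, `p = x i₀`; `Nat.card_eq_fintype_card`, `Fintype.card_subtype`, `Finset.card_union_le`, `Finset.card_map`). -/
theorem stub_defectsGlue : (∀ (N : ℕ) (x : Fin (N + 1) → EuclideanSpace ℝ (Fin 3)) (i₀ : Fin (N + 1)) (j : Fin N) (a : ℝ), 6 / 5 < dist (x (Fin.succAbove i₀ j)) (x i₀) → ((Finset.univ.filter fun k : Fin (N + 1) => k ≠ Fin.succAbove i₀ j ∧ dist (x (Fin.succAbove i₀ j)) (x k) ≤ 6 / 5).image fun k => a⁻¹ • (x k - x (Fin.succAbove i₀ j))) = ((Finset.univ.filter fun k : Fin N => k ≠ j ∧ dist (x (Fin.succAbove i₀ j)) (x (Fin.succAbove i₀ k)) ≤ 6 / 5).image fun k => a⁻¹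 • (x (Fin.succAbove i₀ k) - x (Fin.succAbove i₀ j)))) → (∀ (N : ℕ) (y : Fin N → EuclideanSpace ℝ (Fin 3)) (p : EuclideanSpace ℝ (Fin 3)), ((Finset.univ.filter fun i : Fin N => dist (y i) p ≤ 6 / 5 ∧ ∃ a : ℝ, 9 / 10 ≤ a ∧ a ≤ 11 / 10 ∧ (Literature.Geometry.DiscreteGeometry.ShellCloseTo (1 / 20) ((Finset.univ.filter fun j : Fin N => j ≠ i ∧ dist (y i) (y j) ≤ 6 / 5).image fun j => a⁻¹ • (y j - y i)) Literature.Geometry.DiscreteGeometry.fccKissingPattern ∨ Literature.Geometry.DiscreteGeometry.ShellCloseTo (1 / 20) ((Finset.univ.filter fun j : Fin N => j ≠ i ∧ dist (y i) (y j) ≤ 6 / 5).image fun j => a⁻¹ • (y j - y i)) Literature.Geometry.DiscreteGeometry.hcpKissingPattern))).card ≤ 55) → ∀ (N : ℕ) (x : Fin (N + 1) → EuclideanSpace ℝ (Fin 3)) (i₀ : Fin (N + 1)), Function.Injective x → Nat.card {i : Fin (N + 1) // ¬ ∃ a : ℝ, 9 / 10 ≤ a ∧ a ≤ 11 / 10 ∧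 (Literature.Geometry.DiscreteGeometry.ShellCloseTo (1 / 20) ((Finset.univ.filter fun j : Fin (N + 1) => j ≠ i ∧ dist (x i) (x j) ≤ 6 / 5).image fun j => a⁻¹ • (x j - x i)) Literature.Geometry.DiscreteGeometry.fccKissingPattern ∨ Literature.Geometry.DiscreteGeometry.ShellCloseTo (1 / 20) ((Finset.univ.filter fun j : Fin (N + 1) => j ≠ i ∧ dist (x i) (x j) ≤ 6 / 5).image fun j => a⁻¹ • (x j - x i)) Literature.Geometry.DiscreteGeometry.hcpKissingPattern)} ≤ Nat.card {i : Fin N // ¬ ∃ a : ℝ, 9 / 10 ≤ a ∧ a ≤ 11 / 10 ∧ (Literature.Geometry.DiscreteGeometry.ShellCloseTo (1 / 20) ((Finset.univ.filter fun j : Fin N => j ≠ i ∧ dist (x (Fin.succAbove i₀ i)) (x (Fin.succAbove i₀ j)) ≤ 6 / 5).image fun j => a⁻¹ • (x (Fin.succAbove i₀ j) - x (Fin.succAbove i₀ i))) Literature.Geometry.DiscreteGeometry.fccKissingPattern ∨ Literature.Geometry.DiscreteGeometry.ShellCloseTo (1 / 20) ((Finset.univ.filter fun j : Fin N => j ≠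 i ∧ dist (x (Fin.succAbove i₀ i)) (x (Fin.succAbove i₀ j)) ≤ 6 / 5).image fun j => a⁻¹ • (x (Fin.succAbove i₀ j) - x (Fin.succAbove i₀ i))) Literature.Geometry.DiscreteGeometry.hcpKissingPattern)} + 56 := by
  sorry

/-- D derived: `#Def(x) ≤ #Def(x ∘ i₀.succAbove) + 56` from stubs B, C through the counting glue. -/
theorem defectsSuccAbove_holds : ∀ (N : ℕ) (x : Fin (N + 1) → EuclideanSpace ℝ (Fin 3)) (i₀ : Fin (N + 1)), Function.Injective x → Nat.card {i : Fin (N + 1) // ¬ ∃ a : ℝ, 9 / 10 ≤ a ∧ a ≤ 11 / 10 ∧ (Literature.Geometry.DiscreteGeometry.ShellCloseTo (1 / 20) ((Finset.univ.filter fun j : Fin (N + 1) => j ≠ i ∧ dist (x i) (x j) ≤ 6 / 5).image fun j => a⁻¹ • (x j - x i)) Literature.Geometry.DiscreteGeometry.fccKissingPattern ∨ Literature.Geometry.DiscreteGeometry.ShellCloseTo (1 / 20) ((Finset.univ.filter fun j : Fin (N + 1) => j ≠ i ∧ dist (x i) (x j) ≤ 6 / 5).image fun j => a⁻¹ • (x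 j - x i)) Literature.Geometry.DiscreteGeometry.hcpKissingPattern)} ≤ Nat.card {i : Fin N // ¬ ∃ a : ℝ, 9 / 10 ≤ a ∧ a ≤ 11 / 10 ∧ (Literature.Geometry.DiscreteGeometry.ShellCloseTo (1 / 20) ((Finset.univ.filter fun j : Fin N => j ≠ i ∧ dist (x (Fin.succAbove i₀ i)) (x (Fin.succAbove i₀ j)) ≤ 6 / 5).image fun j => a⁻¹ • (x (Fin.succAbove i₀ j) - x (Fin.succAbove i₀ i))) Literature.Geometry.DiscreteGeometry.fccKissingPattern ∨ Literature.Geometry.DiscreteGeometry.ShellCloseTo (1 / 20) ((Finset.univ.filter fun j : Fin N => j ≠ i ∧ dist (x (Fin.succAbove i₀ i)) (x (Fin.succAbove i₀ j)) ≤ 6 / 5).image fun j => a⁻¹ • (x (Fin.succAbove i₀ j) - x (Fin.succAbove i₀ i))) Literature.Geometry.DiscreteGeometry.hcpKissingPattern)} + 56 :=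
  stub_defectsGlue stub_shellSuccAbove stub_nearGoodCount

/-- STUB 1 derived: closest-pair deletion from D through the induction glue. -/
theorem closestPairDeletion_of_stubs : ∀ g C : ℝ, 0 < g → (⨅ Q : Literature.MathematicalPhysics.StatisticalMechanics.PeriodicConfiguration 3, Q.energyPerParticle Literature.MathematicalPhysics.StatisticalMechanics.lennardJones) < 0 → (∀ (N : ℕ) (x : Fin N → EuclideanSpace ℝ (Fin 3)), Function.Injective x → (∀ i j : Fin N, i ≠ j → (1 / 3 : ℝ) ≤ dist (x i) (x j)) → (N : ℝ) * (⨅ Q : Literature.MathematicalPhysics.StatisticalMechanics.PeriodicConfiguration 3, Q.energyPerParticle Literature.MathematicalPhysics.StatisticalMechanics.lennardJones) + g * (Nat.card {i : Fin N // ¬ ∃ a : ℝ, 9 / 10 ≤ a ∧ a ≤ 11 / 10 ∧ (Literature.Geometry.DiscreteGeometry.ShellCloseTo (1 / 20) ((Finset.univ.filter fun j : Fin N => j ≠ i ∧ dist (x i) (x j) ≤ 6 / 5).image fun j => a⁻¹ • (x j - x i)) Literature.Geometry.DiscreteGeometry.fccKissingPattern ∨ Literature.Geometry.DiscreteGeometry.ShellCloseTo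 (1 / 20) ((Finset.univ.filter fun j : Fin N => j ≠ i ∧ dist (x i) (x j) ≤ 6 / 5).image fun j => a⁻¹ • (x j - x i)) Literature.Geometry.DiscreteGeometry.hcpKissingPattern)} : ℝ) - C * (N : ℝ) ^ (2 / 3 : ℝ) ≤ Literature.MathematicalPhysics.StatisticalMechanics.interactionEnergy Literature.MathematicalPhysics.StatisticalMechanics.lennardJones x) → ∀ (N : ℕ) (x : Fin N → EuclideanSpace ℝ (Fin 3)), Function.Injective x → (N : ℝ) * (⨅ Q : Literature.MathematicalPhysics.StatisticalMechanics.PeriodicConfiguration 3, Q.energyPerParticle Literature.MathematicalPhysics.StatisticalMechanics.lennardJones) + min g (-(⨅ Q : Literature.MathematicalPhysics.StatisticalMechanics.PeriodicConfiguration 3, Q.energyPerParticle Literature.MathematicalPhysics.StatisticalMechanics.lennardJones) / 56) * (Nat.card {i : Fin N // ¬ ∃ a : ℝ, 9 / 10 ≤ a ∧ a ≤ 11 / 10 ∧ (Literature.Geometry.DiscreteGeometry.ShellCloseTo (1 / 20) ((Finset.univ.filter fun j : Fin N => j ≠ i ∧ dist (x i) (x j) ≤ 6 / 5).image fun j =>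 a⁻¹ • (x j - x i)) Literature.Geometry.DiscreteGeometry.fccKissingPattern ∨ Literature.Geometry.DiscreteGeometry.ShellCloseTo (1 / 20) ((Finset.univ.filter fun j : Fin N => j ≠ i ∧ dist (x i) (x j) ≤ 6 / 5).image fun j => a⁻¹ • (x j - x i)) Literature.Geometry.DiscreteGeometry.hcpKissingPattern)} : ℝ) - max C 0 * (N : ℝ) ^ (2 / 3 : ℝ) ≤ Literature.MathematicalPhysics.StatisticalMechanics.interactionEnergy Literature.MathematicalPhysics.StatisticalMechanics.lennardJones x :=
  stub_deletionGlue defectsSuccAbove_holds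

/-! ### Consistency: each named statement IS its registered stub (definitionally) -/

theorem closestPairDeletion_holds : ClosestPairDeletion := closestPairDeletion_of_stubs
theorem twoShellGoodStarGood_holds : TwoShellGoodStarGood := stub_twoShellGoodStarGood
theorem sepTwoShellGap_holds : SepTwoShellGap := stub_separatedTwoShellGap


/-! ## Proved glue I — two-shell good ⇒ star good transfers the inequality (`#Def₁ ≤ #Bad₂`) -/

/-- Under L3, on an injective configuration the star-defect count is at most the two-shell-bad count. -/
theorem defects_le_twoShellDefects (h2 : TwoShellGoodStarGood) {N : ℕ} {x : Fin N → E3}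
    (hx : Function.Injective x) : defects x ≤ twoShellDefects x := by
  unfold defects twoShellDefects
  rw [Nat.card_eq_fintype_card, Nat.card_eq_fintype_card]
  exact Fintype.card_subtype_mono _ _ fun i hi hgood => hi (h2 N x i hx hgood)

/-- A `1/3`-separated configuration is injective. -/
theorem injective_of_isSeparated {N : ℕ} {x : Fin N → E3} (hs : IsSeparated x) : Function.Injective x := by
  intro i j hij
  by_contra hne
  have h := hs i j hne
  rw [hij, dist_self] at h
  linarith

/-- R2 with constants `(g, C)`, `g ≥ 0`, and L3 give R1 with the same constants. -/
theorem sepStar_of_sepTwoShell (h2 : TwoShellGoodStarGood) {g C : ℝ} (hg : 0 ≤ g)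
    (h3 : SepTwoShellGapWith g C) : SepStarCoercivityWith g C := by
  intro N x hx hs
  have hle : (defects x : ℝ) ≤ (twoShellDefects x : ℝ) := by
    exact_mod_cast defects_le_twoShellDefects h2 hx
  have := h3 N x hs
  nlinarith [mul_le_mul_of_nonneg_left hle hg]

/-! ## Proved glue II — the vacuum competitor: `SepStarCoercivityWith g C → g ≤ −e_per`
(after `Disproof.lean` §2–3, which is not importable; the collinear configuration is `2`-separated, hence
`1/3`-separated, so the separated inequality already sees it) -/

/-- If every site is star-defective then `#Def(x) = N`. -/
theorem defects_eq_of_forall {N : ℕ} {x : Fin N → E3} (h : ∀ i, ¬ IsStarGood x i) : defects x = N := by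
  unfold defects
  rw [Nat.card_congr (Equiv.subtypeUnivEquiv h)]
  simp

/-- A site whose rescaled shell never has exactly twelve points is star-defective. -/
theorem not_isStarGood_of_card_ne {N : ℕ} {x : Fin N → E3} {i : Fin N}
    (h : ∀ a : ℝ, 9 / 10 ≤ a → a ≤ 11 / 10 → (shell x i a).card ≠ 12) : ¬ IsStarGood x i := by
  rintro ⟨a, ha₁, ha₂, hclose⟩
  exact h a ha₁ ha₂ (card_eq_twelve_of_shellCloseTo hclose)

/-- `(M³)^(2/3) = M²`. -/
theorem cube_rpow_two_thirds (M : ℕ) : (((M : ℝ) ^ 3) ^ (2 / 3 : ℝ)) = (M : ℝ) ^ 2 := by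
  have hM : (0 : ℝ) ≤ (M : ℝ) := Nat.cast_nonneg M
  rw [show ((M : ℝ) ^ 3) = (M : ℝ) ^ (3 : ℝ) by norm_cast, ← Real.rpow_mul hM]
  norm_num

/-- The unit vector `e₀`. -/
def e0 : E3 := EuclideanSpace.single 0 1

theorem norm_e0 : ‖e0‖ = 1 := by simp [e0]

/-- `N` points on a line at spacing `2`: every `6/5`-shell is empty, every pair term is `≤ 0`. -/
def lineConfig (N : ℕ) : Fin N → E3 := fun i => ((2 : ℝ) * (i : ℕ)) • e0

theorem dist_lineConfig {N : ℕ} (i j : Fin N) :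
    dist (lineConfig N i) (lineConfig N j) = 2 * |((i : ℕ) : ℝ) - ((j : ℕ) : ℝ)| := by
  simp only [lineConfig, dist_eq_norm, ← sub_smul, norm_smul, norm_e0, mul_one, ← mul_sub,
    Real.norm_eq_abs, abs_mul, abs_two]

theorem two_le_dist_lineConfig {N : ℕ} {i j : Fin N} (hij : i ≠ j) :
    2 ≤ dist (lineConfig N i) (lineConfig N j) := by
  rw [dist_lineConfig]
  have hne : (i : ℕ) ≠ (j : ℕ) := fun h => hij (Fin.ext h)
  have h1 : (1 : ℝ) ≤ |((i : ℕ) : ℝ) - ((j : ℕ) : ℝ)| := by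
    rcases Nat.lt_or_gt_of_ne hne with h | h
    · have : ((i : ℕ) : ℝ) + 1 ≤ ((j : ℕ) : ℝ) := by exact_mod_cast h
      rw [abs_of_neg (by linarith)]
      linarith
    · have : ((j : ℕ) : ℝ) + 1 ≤ ((i : ℕ) : ℝ) := by exact_mod_cast h
      rw [abs_of_pos (by linarith)]
      linarith
  linarith

theorem isSeparated_lineConfig (N : ℕ) : IsSeparated (lineConfig N) := fun _ _ hij => by
  linarith [two_le_dist_lineConfig (N := N) hij]

theorem lineConfig_injective (N : ℕ) : Function.Injective (lineConfig N) :=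
  injective_of_isSeparated (isSeparated_lineConfig N)

/-- Every shell of the collinear configuration is empty, so every site is star-defective. -/
theorem shell_lineConfig {N : ℕ} (i : Fin N) (a : ℝ) : shell (lineConfig N) i a = ∅ := by
  unfold shell
  rw [Finset.image_eq_empty, Finset.filter_eq_empty_iff]
  rintro j - ⟨hji, hdist⟩
  have := two_le_dist_lineConfig (N := N) (Ne.symm hji)
  linarith

theorem defects_lineConfig (N : ℕ) : defects (lineConfig N) = N :=
  defects_eq_of_forall fun i => not_isStarGood_of_card_ne fun a _ _ => by
    rw [shell_lineConfig i a]; simp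

theorem interactionEnergy_lineConfig_nonpos (N : ℕ) :
    interactionEnergy lennardJones (lineConfig N) ≤ 0 := by
  unfold interactionEnergy
  refine Finset.sum_nonpos fun i _ => Finset.sum_nonpos fun j hj => ?_
  have hij : i ≠ j := (Finset.mem_Ioi.1 hj).ne
  exact lennardJones_nonpos (by linarith [two_le_dist_lineConfig (N := N) hij])

/-- **Tightness at the vacuum, separated form**: `SepStarCoercivityWith g C → g ≤ −e_per`. -/
theorem g_le_neg_ePer_of_sep {g C : ℝ} (h : SepStarCoercivityWith g C) : g ≤ -ePer := by
  by_contra hlt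
  push Not at hlt
  set c : ℝ := ePer + g with hc_def
  have hc : 0 < c := by rw [hc_def]; linarith
  obtain ⟨M, hM⟩ := exists_nat_gt (|C| / c)
  have hMpos : (0 : ℝ) < M := lt_of_le_of_lt (by positivity) hM
  have key := h (M ^ 3) (lineConfig (M ^ 3)) (lineConfig_injective _) (isSeparated_lineConfig _)
  rw [defects_lineConfig] at key
  have hE := interactionEnergy_lineConfig_nonpos (M ^ 3)
  push_cast at key
  rw [cube_rpow_two_thirds] at key
  have h1 : c * (M : ℝ) ^ 3 ≤ C * (M : ℝ) ^ 2 := by rw [hc_def]; nlinarith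
  have h2 : c * (M : ℝ) ≤ C := by
    have hM2 : (0 : ℝ) < (M : ℝ) ^ 2 := by positivity
    have : c * (M : ℝ) * (M : ℝ) ^ 2 ≤ C * (M : ℝ) ^ 2 := by nlinarith
    exact le_of_mul_le_mul_right this hM2
  have h3 : |C| < c * (M : ℝ) := by rwa [div_lt_iff₀ hc, mul_comm] at hM
  linarith [le_abs_self C]

/-- Hence a separated inequality with `g > 0` forces `e_per < 0`. -/
theorem ePer_neg_of_sep {g C : ℝ} (hg : 0 < g) (h : SepStarCoercivityWith g C) : ePer < 0 := by
  linarith [g_le_neg_ePer_of_sep h]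

/-! ## The composition: the three stubs imply the crux, BY NAME -/

/-- `StarCoercivity` from the three stubs (pure logic on top of the proved glue; no `sorry` outside the stubs):
R2 `(g, C)` and L3 give R1 `(g, C)`; the vacuum competitor gives `e_per ≤ −g < 0`; L1 gives the crux inequality
for all injective configurations with `(min g (−e_per/56), max C 0)`, and `min g (−e_per/56) > 0`. -/
theorem starCoercivity_of_hyps (h1 : ClosestPairDeletion) (h2 : TwoShellGoodStarGood) (h3 : SepTwoShellGap) :
    ∃ g : ℝ, 0 < g ∧ ∃ C : ℝ, StarCoercivityWith g C := by
  obtain ⟨g, hg, C, hgap⟩ := h3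
  have hR1 : SepStarCoercivityWith g C := sepStar_of_sepTwoShell h2 hg.le hgap
  have he : ePer < 0 := ePer_neg_of_sep hg hR1
  have hpos : 0 < min g (-ePer / 56) := lt_min hg (by linarith)
  exact ⟨min g (-ePer / 56), hpos, max C 0, h1 g C hg he hR1⟩

/-- **The line concludes the crux BY NAME**, hypothesis-free: the registered stubs (through the derived
`closestPairDeletion_holds`, `twoShellGoodStarGood_holds`, `sepTwoShellGap_holds`) fed into `starCoercivity_of_hyps`. -/
theorem StarCoercivity_of :
    Summit.AtomisticToContinuum.Crystallization.Theses.ReggeStarCoercivity.StarCoercivity :=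
  starCoercivity_iff.2 (starCoercivity_of_hyps closestPairDeletion_holds twoShellGoodStarGood_holds sepTwoShellGap_holds)

/-! ## Other entries (kernel-checked; not registered) -/

/-- ENTRY FROM THE SIBLING ROUTE: `PhononSlackCertificates.CoerciveTwoShellGap` (stmt-13956, all `δ > 0`, `C = 0`)
gives STUB 3 (`δ = 1/3`, `C = 0`). So a proof of 13956 closes this crux through L3 + L1. -/
theorem sepTwoShellGap_of_coerciveTwoShellGap
    (h : Summit.AtomisticToContinuum.Crystallization.Theses.PhononSlackCertificates.CoerciveTwoShellGap) :
    SepTwoShellGap := by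
  obtain ⟨g, hg, hh⟩ := h (1 / 3) (by norm_num)
  refine ⟨g, hg, 0, fun N x hs => ?_⟩
  have := hh N x hs
  simp only [zero_mul, sub_zero]
  exact this

/-- ENTRY FOR THE ROUTE'S OWN ENGINE (one-shell stars on separated configurations, the form the handover cards
quantify over): a direct proof of R1 = `SepStarCoercivity` closes the crux through L1 alone — the conclusion below is
the crux's body (`starCoercivity_iff` is `Iff.rfl`). -/
theorem starCoercivityBody_of_sepStar (h1 : ClosestPairDeletion) (h : SepStarCoercivity) :
    ∃ g : ℝ, 0 < g ∧ ∃ C : ℝ, StarCoercivityWith g C := by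
  obtain ⟨g, hg, C, hR1⟩ := h
  have he : ePer < 0 := ePer_neg_of_sep hg hR1
  exact ⟨min g (-ePer / 56), lt_min hg (by linarith), max C 0, h1 g C hg he hR1⟩

/-- THE TORUS FORM of R2 (lever (ii) of the card, relocated to the two-shell predicate): `∃ g > 0` such that every
periodic configuration of `ℝ³` whose point set is `1/3`-separated has
`e(P) ≥ e_per + g · #{s ∈ motif : ¬ IsTwoShellGoodSet (1/20) (47/50) 1 P.points s} / #motif`. On `ℝ³/Λ` there is no
boundary and no `C`; flatness identities and Euler counts are equalities. Not registered (triage r1: the padding lever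
is `Disproof.lean` §9/§12); see `SeparatedPeriodisation`. -/
def TorusTwoShellGap : Prop :=
  ∃ g : ℝ, 0 < g ∧ ∀ P : PeriodicConfiguration 3,
    (∀ u ∈ P.points, ∀ v ∈ P.points, u ≠ v → (1 / 3 : ℝ) ≤ dist u v) →
      ePer + g * (((P.motif.filter fun s => ¬ IsTwoShellGoodSet (1 / 20) (47 / 50) 1 P.points s).card : ℝ) /
        (P.motif.card : ℝ)) ≤ P.energyPerParticle lennardJones

/-- THE TORUS ENTRY (provable now, M; pattern of `Disproof.lean` §9 `starCoercivity_of_periodicStarCoercivity`):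
periodise a `1/3`-separated finite `x` with the cubic lattice of period `L ≥ 2Σ‖xᵢ‖ + 2` (`cubicLattice`,
`le_norm_of_mem_cubicLattice`); cross-copy distances are `≥ 2`, so the periodisation is `1/3`-separated, its
`3a/2`-neighbourhoods read in `P.points` are those of `x` (`IsTwoShellGoodSet … P.points (x i) ↔ IsTwoShellGood … x i`,
cf. `toFinset_inter_points_image`), and `N·e(P) ≤ E(x)` (`V ≤ 0` beyond `1`, `summable_lennardJones_dist_three`).
A lead who wants the torus as home adds `theorem stub_separatedPeriodisation : SeparatedPeriodisation := by sorry`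
and composes `SepTwoShellGap` from it and a torus stub. -/
def SeparatedPeriodisation : Prop := TorusTwoShellGap → SepTwoShellGap

end Summit.AtomisticToContinuum.Crystallization.Cruxes.StarCoercivity.SeparationPaddingTransfer

end
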